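import Summits.ValiantsHypothesis.ValiantsHypothesis.Theorems.KPlusLogSqLawTropicalBForbiddenPatterns

/-!
# Route «KPlusLogSqLaw», crux `TropicalB` (stmt-ValiantsHypothesis-19771) — certificate kit for the `(3,5)` row:
# an ORDER-TYPE pairwise-law search whose refutations are checked by `decide`, and its soundness

HONEST FRAMING.  Helper toward the crux (cell `pub-symmetroid`, seat val-sym-trop-p4 g5, 2026-08-27; `--supports … --as helper`).  This file
contains NO census claim by itself: it is the generic machinery with which the seat's located result «T(3,5) ≤ 33» (memo THREE-FIVE-g5.md) is
being moved into the kernel cell by cell (sequel files `…ThreeFiveCert*` / `…ThreeFiveRow`).  Nothing here bears on `TropicalB` in its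
window, `WeakLifting`, the doors, `MatrixDescartes` (stmt-ValiantsHypothesis-18050) or VP ≠ VNP.

CONTENT (m = 3, K = 5, classes `Fin 5`, exponents `d : Fin 5 → ℕ` strictly increasing).
* `domO R2 R3 P Q` — Boolean test (permutations as vectors `Fin 3 → Fin 3`, `abs`) that the pair (P earlier, Q later) violates the pairwise exchange law GIVEN a list `R2` of known strict
  relations between pair sums (`((a,b),(c,e))` meaning `d a + d b < d c + d e`) and `R3` between triple sums: some column set `T` invariant
  under `σ_P⁻¹σ_Q` on which the terms differ and the `T`-classes of `Q` are known NOT to out-slope those of `P` (equal multiset, class order for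
  `|T| = 1`, or a listed relation).  `domO_sound`: impossible for unique optima at `θ < θ'` when `d` is monotone and the listed relations hold
  (cyclewise exchange `sum_d_lt_of_isDominant_invariant`).
* `search R2 R3 asg rest` — depth-first refutation: every way of realising the histograms of `rest` (each with its list of class arrangements,
  any permutation) after the already placed terms `asg` hits a violated pair.  `search_sound`: if `search … [] pattern = true` then no dominant
  chain realises the pattern in this order.  (Part 2, `…ThreeFiveBound`: `le_33_of_search`, ties, row relabelling; arrangement tables:
  `…ThreeFiveArr`.)  [this cell]
-/

-- `Summit.ValiantsHypothesis.ValiantsHypothesis.…` repeats a component by the D-0017 layout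
-- (single-conjunct summit), which the `dupNamespace` linter flags; the name is mandated.
set_option linter.dupNamespace false
set_option autoImplicit false

namespace Summit.ValiantsHypothesis.ValiantsHypothesis.Theorems.KPlusLogSqLaw

open Summit.ValiantsHypothesis.ValiantsHypothesis.Theorems.MatrixDescartes.Negative
open Summit.ValiantsHypothesis.ValiantsHypothesis.Theorems.LacunarySymmetroidMatrixDescartes.TropicalCensus
open Finset ForbiddenPatterns

namespace ThreeFive

/-! ## 1. The order-type domination test -/

/-- abstract term: the permutation as a VECTOR `Fin 3 → Fin 3` (the graph `b ↦ σ b`) and the class vector. -/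
abbrev AT := (Fin 3 → Fin 3) × (Fin 3 → Fin 5)

/-- abstraction of a term. -/
def abs (t : Equiv.Perm (Fin 3) × (Fin 3 → Fin 5)) : AT := (⇑t.1, t.2)

/-- the six permutation vectors of `Fin 3`. -/
def S3V : List (Fin 3 → Fin 3) := [![0, 1, 2], ![0, 2, 1], ![1, 0, 2], ![1, 2, 0], ![2, 0, 1], ![2, 1, 0]]

/-- every permutation's vector is listed. -/
theorem mem_S3V (σ : Equiv.Perm (Fin 3)) : (⇑σ : Fin 3 → Fin 3) ∈ S3V := by
  revert σ
  decide

/-- known strict relations between pair sums: `((a,b),(c,e))` encodes `d a + d b < d c + d e` (entries sorted). -/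
abbrev Rel2 := List ((Fin 5 × Fin 5) × (Fin 5 × Fin 5))

/-- known strict relations between triple sums (entries sorted). -/
abbrev Rel3 := List ((Fin 5 × Fin 5 × Fin 5) × (Fin 5 × Fin 5 × Fin 5))

/-- sort a pair of classes. -/
def sort2 (x : Fin 5 × Fin 5) : Fin 5 × Fin 5 := if x.1 ≤ x.2 then x else (x.2, x.1)
/-- compare-swap of the first two entries of a triple. -/
def s12 (x : Fin 5 × Fin 5 × Fin 5) : Fin 5 × Fin 5 × Fin 5 := if x.1 ≤ x.2.1 then x else (x.2.1, x.1, x.2.2)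
/-- compare-swap of the last two entries of a triple. -/
def s23 (x : Fin 5 × Fin 5 × Fin 5) : Fin 5 × Fin 5 × Fin 5 := if x.2.1 ≤ x.2.2 then x else (x.1, x.2.2, x.2.1)
/-- sort a triple of classes (three compare-swaps). -/
def sort3 (x : Fin 5 × Fin 5 × Fin 5) : Fin 5 × Fin 5 × Fin 5 := s12 (s23 (s12 x))

/-- `x` is known to have pair sum `≥` that of `y`: componentwise domination of the sorted pairs, or a listed strict relation. -/
def ge2 (R : Rel2) (x y : Fin 5 × Fin 5) : Bool :=
  decide ((sort2 y).1 ≤ (sort2 x).1 ∧ (sort2 y).2 ≤ (sort2 x).2) || decide ((sort2 y, sort2 x) ∈ R)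

/-- `x` is known to have triple sum `≥` that of `y`: componentwise domination of the sorted triples, or a listed strict relation. -/
def ge3 (R : Rel3) (x y : Fin 5 × Fin 5 × Fin 5) : Bool :=
  decide ((sort3 y).1 ≤ (sort3 x).1 ∧ (sort3 y).2.1 ≤ (sort3 x).2.1 ∧ (sort3 y).2.2 ≤ (sort3 x).2.2) ||
    decide ((sort3 y, sort3 x) ∈ R)

/-- invariance of the column set `T` (the two permutations carry `T` onto the same rows) and «the terms differ on `T`». -/
def invDif (P Q : AT) (T : Fin 3 → Bool) : Bool :=
  decide (∀ b, T b = true → (∃ b', T b' = true ∧ P.1 b' = Q.1 b) ∧ (∃ b', T b' = true ∧ Q.1 b' = P.1 b)) &&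
    decide (∃ b, T b = true ∧ (P.1 b ≠ Q.1 b ∨ P.2 b ≠ Q.2 b))

/-- **order-type domination test** for (earlier `P`, later `Q`): one of the seven column sets violates the pairwise law given the known
relations (singletons: class order; pairs: `ge2`; the full set: `ge3`). -/
def domO (R2 : Rel2) (R3 : Rel3) (P Q : AT) : Bool :=
  (invDif P Q ![true, false, false] && decide (Q.2 0 ≤ P.2 0)) ||
  (invDif P Q ![false, true, false] && decide (Q.2 1 ≤ P.2 1)) ||
  (invDif P Q ![false, false, true] && decide (Q.2 2 ≤ P.2 2)) ||
  (invDif P Q ![true, true, false] && ge2 R2 (P.2 0, P.2 1) (Q.2 0, Q.2 1)) ||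
  (invDif P Q ![true, false, true] && ge2 R2 (P.2 0, P.2 2) (Q.2 0, Q.2 2)) ||
  (invDif P Q ![false, true, true] && ge2 R2 (P.2 1, P.2 2) (Q.2 1, Q.2 2)) ||
  (invDif P Q ![true, true, true] && ge3 R3 (P.2 0, P.2 1, P.2 2) (Q.2 0, Q.2 1, Q.2 2))

section Sound

variable (d : Fin 5 → ℕ) (v ε : Fin 3 → Fin 3 → Fin 5 → ℤ) (R2 : Rel2) (R3 : Rel3)

/-- pair sums are invariant under `sort2`. -/
theorem sum_sort2 (x : Fin 5 × Fin 5) : d (sort2 x).1 + d (sort2 x).2 = d x.1 + d x.2 := by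
  unfold sort2; split_ifs <;> [rfl; ring]

/-- triple sums are invariant under `sort3`. -/
theorem sum_sort3 (x : Fin 5 × Fin 5 × Fin 5) :
    d (sort3 x).1 + d (sort3 x).2.1 + d (sort3 x).2.2 = d x.1 + d x.2.1 + d x.2.2 := by
  have h12 : ∀ y : Fin 5 × Fin 5 × Fin 5, d (s12 y).1 + d (s12 y).2.1 + d (s12 y).2.2 = d y.1 + d y.2.1 + d y.2.2 := by
    intro y; unfold s12; split_ifs <;> [rfl; ring]
  have h23 : ∀ y : Fin 5 × Fin 5 × Fin 5, d (s23 y).1 + d (s23 y).2.1 + d (s23 y).2.2 = d y.1 + d y.2.1 + d y.2.2 := by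
    intro y; unfold s23; split_ifs <;> [rfl; ring]
  unfold sort3
  rw [h12, h23, h12]

/-- soundness of `ge2`. -/
theorem sum_le_of_ge2 (hmono : Monotone d) (hR2 : ∀ r ∈ R2, d r.1.1 + d r.1.2 < d r.2.1 + d r.2.2)
    (x y : Fin 5 × Fin 5) (h : ge2 R2 x y = true) : d y.1 + d y.2 ≤ d x.1 + d x.2 := by
  unfold ge2 at h
  rw [Bool.or_eq_true, decide_eq_true_eq, decide_eq_true_eq] at h
  rw [← sum_sort2 d x, ← sum_sort2 d y]
  rcases h with ⟨h1, h2⟩ | h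
  · exact Nat.add_le_add (hmono h1) (hmono h2)
  · exact (hR2 _ h).le

/-- soundness of `ge3`. -/
theorem sum_le_of_ge3 (hmono : Monotone d)
    (hR3 : ∀ r ∈ R3, d r.1.1 + d r.1.2.1 + d r.1.2.2 < d r.2.1 + d r.2.2.1 + d r.2.2.2)
    (x y : Fin 5 × Fin 5 × Fin 5) (h : ge3 R3 x y = true) : d y.1 + d y.2.1 + d y.2.2 ≤ d x.1 + d x.2.1 + d x.2.2 := by
  unfold ge3 at h
  rw [Bool.or_eq_true, decide_eq_true_eq, decide_eq_true_eq] at h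
  rw [← sum_sort3 d x, ← sum_sort3 d y]
  rcases h with ⟨h1, h2, h3⟩ | h
  · exact Nat.add_le_add (Nat.add_le_add (hmono h1) (hmono h2)) (hmono h3)
  · exact (hR3 _ h).le

/-- the exchange law on an explicit column set: if `T` passes `invDif` for the abstractions of two unique optima at `θ < θ'`, the `T`-part of
the slope strictly increases. -/
theorem sum_lt_of_invDif {θ θ' : ℤ} (hθ : θ < θ') (P Q : Equiv.Perm (Fin 3) × (Fin 3 → Fin 5))
    (hP : IsDominant d v ε θ P) (hQ : IsDominant d v ε θ' Q) (T : Fin 3 → Bool) (h : invDif (abs P) (abs Q) T = true) :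
    ∑ b ∈ univ.filter (fun b => T b = true), (d (P.2 b) : ℤ) < ∑ b ∈ univ.filter (fun b => T b = true), (d (Q.2 b) : ℤ) := by
  classical
  unfold invDif abs at h
  rw [Bool.and_eq_true, decide_eq_true_eq, decide_eq_true_eq] at h
  obtain ⟨hinv, b₀, hb₀, hdiff⟩ := h
  have hmem : ∀ b, b ∈ univ.filter (fun b => T b = true) ↔ T b = true := fun b => by simp
  obtain ⟨σ, c⟩ := P
  obtain ⟨ρ, μ⟩ := Q
  refine sum_d_lt_of_isDominant_invariant d v ε hθ hP hQ _ (fun b => ?_) ⟨b₀, (hmem b₀).mpr hb₀, hdiff⟩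
  rw [hmem, hmem]
  constructor
  · intro h1
    -- `σ⁻¹ (ρ b) ∈ T`, so `ρ b = σ b''` with `b'' ∈ T`, hence `b ∈ T` by the second half of invariance and injectivity of `ρ`
    obtain ⟨-, ⟨b', hb', hb'eq⟩⟩ := hinv _ h1
    have e1 : σ ((σ⁻¹ * ρ) b) = ρ b := by simp
    have : ρ b' = ρ b := by
      have := hb'eq
      simp only at this
      rw [this, e1]
    rwa [← ρ.injective this]
  · intro h1
    obtain ⟨⟨b', hb', hb'eq⟩, -⟩ := hinv _ h1
    have : (σ⁻¹ * ρ) b = b' := by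
      simp only at hb'eq
      simp [Equiv.Perm.mul_apply, ← hb'eq]
    rw [this]; exact hb'

/-- **soundness of `domO`**: with `d` monotone and the listed relations true, no (earlier, later) pair of unique optima passes the test. -/
theorem domO_sound (hmono : Monotone d)
    (hR2 : ∀ r ∈ R2, d r.1.1 + d r.1.2 < d r.2.1 + d r.2.2)
    (hR3 : ∀ r ∈ R3, d r.1.1 + d r.1.2.1 + d r.1.2.2 < d r.2.1 + d r.2.2.1 + d r.2.2.2)
    {θ θ' : ℤ} (hθ : θ < θ') (P Q : Equiv.Perm (Fin 3) × (Fin 3 → Fin 5)) (hP : IsDominant d v ε θ P)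
    (hQ : IsDominant d v ε θ' Q) (h : domO R2 R3 (abs P) (abs Q) = true) : False := by
  classical
  have key := fun T hT => sum_lt_of_invDif d v ε hθ P Q hP hQ T hT
  have e1 : (univ.filter fun b : Fin 3 => (![true, false, false] : Fin 3 → Bool) b = true) = {0} := by decide
  have e2 : (univ.filter fun b : Fin 3 => (![false, true, false] : Fin 3 → Bool) b = true) = {1} := by decide
  have e3 : (univ.filter fun b : Fin 3 => (![false, false, true] : Fin 3 → Bool) b = true) = {2} := by decide
  have e4 : (univ.filter fun b : Fin 3 => (![true, true, false] : Fin 3 → Bool) b = true) = {0, 1} := by decide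
  have e5 : (univ.filter fun b : Fin 3 => (![true, false, true] : Fin 3 → Bool) b = true) = {0, 2} := by decide
  have e6 : (univ.filter fun b : Fin 3 => (![false, true, true] : Fin 3 → Bool) b = true) = {1, 2} := by decide
  have e7 : (univ.filter fun b : Fin 3 => (![true, true, true] : Fin 3 → Bool) b = true) = {0, 1, 2} := by decide
  have hm : ∀ a b : Fin 5, a ≤ b → (d a : ℤ) ≤ d b := fun a b hab => by exact_mod_cast hmono hab
  have hP2 : (abs P).2 = P.2 := rfl
  have hQ2 : (abs Q).2 = Q.2 := rfl
  unfold domO at h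
  simp only [Bool.or_eq_true, Bool.and_eq_true, decide_eq_true_eq, hP2, hQ2] at h
  rcases h with ((((((⟨h1, hle⟩ | ⟨h1, hle⟩) | ⟨h1, hle⟩) | ⟨h1, hge⟩) | ⟨h1, hge⟩) | ⟨h1, hge⟩) | ⟨h1, hge⟩)
  · have k := key _ h1; rw [e1, sum_singleton, sum_singleton] at k; linarith [hm _ _ hle]
  · have k := key _ h1; rw [e2, sum_singleton, sum_singleton] at k; linarith [hm _ _ hle]
  · have k := key _ h1; rw [e3, sum_singleton, sum_singleton] at k; linarith [hm _ _ hle]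
  · have k := key _ h1
    rw [e4, sum_pair (by decide), sum_pair (by decide)] at k
    have := sum_le_of_ge2 d R2 hmono hR2 _ _ hge
    simp only at this
    linarith
  · have k := key _ h1
    rw [e5, sum_pair (by decide), sum_pair (by decide)] at k
    have := sum_le_of_ge2 d R2 hmono hR2 _ _ hge
    simp only at this
    linarith
  · have k := key _ h1
    rw [e6, sum_pair (by decide), sum_pair (by decide)] at k
    have := sum_le_of_ge2 d R2 hmono hR2 _ _ hge
    simp only at this
    linarith
  · have k := key _ h1
    rw [e7, sum_insert (by decide), sum_pair (by decide), sum_insert (by decide), sum_pair (by decide)] at k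
    have := sum_le_of_ge3 d R3 hmono hR3 _ _ hge
    simp only at this
    linarith

end Sound

/-! ## 2. The refutation search and its soundness -/

/-- **depth-first refutation.**  `search R2 R3 asg rest = true` iff EVERY way of realising the histograms of `rest` in order (each by any
permutation vector and any class arrangement from its list), after the already placed abstract terms `asg`, contains a pair (earlier, later)
passing `domO`. -/
def search (R2 : Rel2) (R3 : Rel3) : List AT → List (List (Fin 3 → Fin 5)) → Bool
  | _, [] => false
  | asg, arrs :: rest => arrs.all fun c => S3V.all fun σ =>
      (asg.any fun a => domO R2 R3 a (σ, c)) || search R2 R3 (asg ++ [(σ, c)]) rest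

section Sound

variable (d : Fin 5 → ℕ) (v ε : Fin 3 → Fin 3 → Fin 5 → ℤ) (R2 : Rel2) (R3 : Rel3)

/-- **soundness of the search**: a refuted pattern is realised by no increasing family of unique optima (placed terms `asg` earlier than the
family `fut`, `fut` increasing in the parameter, class vectors from the prescribed lists). -/
theorem search_sound (hmono : Monotone d)
    (hR2 : ∀ r ∈ R2, d r.1.1 + d r.1.2 < d r.2.1 + d r.2.2)
    (hR3 : ∀ r ∈ R3, d r.1.1 + d r.1.2.1 + d r.1.2.2 < d r.2.1 + d r.2.2.1 + d r.2.2.2) :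
    ∀ (rest : List (List (Fin 3 → Fin 5))) (asg fut : List (ℤ × (Equiv.Perm (Fin 3) × (Fin 3 → Fin 5)))),
      search R2 R3 (asg.map fun a => abs a.2) rest = true →
      List.Forall₂ (fun f arrs => f.2.2 ∈ arrs) fut rest →
      (∀ a ∈ asg, IsDominant d v ε a.1 a.2) → (∀ f ∈ fut, IsDominant d v ε f.1 f.2) →
      (∀ a ∈ asg, ∀ f ∈ fut, a.1 < f.1) → fut.Pairwise (fun f g => f.1 < g.1) → False := by
  intro rest
  induction rest with
  | nil =>
    intro asg fut hs
    simp [search] at hs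
  | cons arrs rest ih =>
    intro asg fut hs hF hasg hfut hlt hpw
    cases hF with
    | cons hmem hrest =>
      rename_i f fut'
      simp only [search, List.all_eq_true, Bool.or_eq_true, List.any_eq_true] at hs
      rcases hs f.2.2 hmem (⇑f.2.1) (mem_S3V _) with ⟨a, ha, hdom⟩ | hs'
      · obtain ⟨a', ha', rfl⟩ := List.mem_map.mp ha
        exact domO_sound d v ε R2 R3 hmono hR2 hR3 (hlt a' ha' f (List.mem_cons_self)) a'.2 f.2
          (hasg a' ha') (hfut f (List.mem_cons_self)) hdom
      · refine ih (asg ++ [f]) fut' ?_ hrest ?_ ?_ ?_ ?_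
        · simpa [List.map_append, abs] using hs'
        · intro a ha
          rcases List.mem_append.mp ha with ha | ha
          · exact hasg a ha
          · rw [List.mem_singleton] at ha
            subst ha
            exact hfut _ (List.mem_cons_self)
        · exact fun g hg => hfut g (List.mem_cons_of_mem _ hg)
        · intro a ha g hg
          rcases List.mem_append.mp ha with ha | ha
          · exact hlt a ha g (List.mem_cons_of_mem _ hg)
          · rw [List.mem_singleton] at ha
            subst ha
            exact List.rel_of_pairwise_cons hpw hg
        · exact hpw.of_cons

end Sound

end ThreeFive

end Summit.ValiantsHypothesis.ValiantsHypothesis.Theorems.KPlusLogSqLaw
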